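import Literature.MathematicalPhysics.QuantumFieldTheory.Balaban1983to89.B8Eq1115Concrete
import Literature.MathematicalPhysics.QuantumFieldTheory.Balaban1983to89.B8Eq131Derivation

/-!
# `Balaban1983to89.B8Eq106Local` — T. Bałaban, *Spaces of regular gauge field configurations on a lattice and gauge fixing
# conditions*, Commun. Math. Phys. **99** (1985) 75–102 [Balaban1985RegularSpaces] ("B8"), proof of Theorem 4, p. 88: «From
# (64)–(87) of [3] it follows that `u₁` is determined uniquely in terms of `U₁` and is given by (106)» — IN B8's MULTI-DOMAIN
# GEOMETRY: on the block tower `Bʲ(y)` under a site `y ∈ Λ_j` the inductive gauge transformation IS the gauge fixing (104)–(106)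
# of [3] at top level `j`; whence (1.72)–(1.74) FOR `u₁` ITSELF (concrete `ℤᵈ` carriers, general background, local hypotheses)

statement-level skeleton of published theorems with citation tags; proofs where landed; nothing here is a claim about the
Yang–Mills mass gap

PDF held: `paper:balaban1985-cmp99-regular-spaces-gauge-fixing` (journal page = PDF page + 74); p. 88 [PDF 14] read as an image,
pp. 79, 81 [PDF 5, 7] through the verbatim quotations of `B8Eq119TwistedAxial` / `B8Eq131Derivation` ((1.19), (1.29)); [3] =
[Balaban1985Averaging] (67), (76)–(77), (81), (87) pp. 29–31, (104)–(106) p. 33 as quoted and proved in `B7Eq84Concrete` /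
`B7Eq106Concrete`.

WHAT IS PRINTED.  B8 p. 88: "Applying the inductive hypothesis we get a gauge transformation `u₁` such that `(\overline{R₀u₁})ʲ(y) = 1`
for `y ∈ Λ_j`, `j = 0, 1, …, k − 2`, and for `y ∈ Λ_{k−1} ∪ B(Λ_k)`, `j = k − 1`, (1.68) `U₁ = U′^{u₁⁻¹} = … = e^{iηA}`, … (1.69) …
Let us consider the gauge transformation `u₁`. From (64)–(87) of [3] it follows that `u₁` is determined uniquely in terms of `U₁` and
is given by (106)."  The data: `U′U₀ ∈ Ax_k(𝔅_k, U₀)` ((1.34); (1.19) p. 79: the block axial gauge conditions RELATIVE TO `U₀` in the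
tower under every `x_j ∈ Λ_j`) and `U′ = U₁^{u₁}` ((1.17) = (55) of [3]).  [3] p. 31: "Thus the gauge transformation is uniquely
determined by all the conditions and is given by the formulas (77) for `j = k − 1` and by (87)."

WHY THIS FILE.  `B7Eq84Concrete.gaugeFixing_unique` / `gauge_formula` prove [3]'s uniqueness with the gauge conditions (67) on ALL of
`ℤᵈ` and (81) on the whole top lattice; `B8Eq131Derivation.eq87_local` localises the TOP VALUE ((87) at one site `y` from (1.19) in
the tower under `y` and (1.29) at `y`).  B8's inductive `u₁` satisfies (1.19) only in the towers under `𝔅_k` and (1.29) only on the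
`Λ_j`, and the regularity statements (1.70)–(1.74) / (213)–(214) landed for the CONSTRUCTED gauge fixing `glev … j 0`
(`B8Ineq172Concrete`) apply to `u₁` once `u₁ = glev … j 0` is known ON THE WHOLE TOWER `Bʲ(y)` — the content of the quoted sentence
in the multi-domain geometry.  This file proves it (print's downward induction (77): (87) at `y`, then (76) block by block) and
draws the consequences for `u₁` itself.

WHAT THIS FILE PROVES (kernel, 0 sorry, theorems only, no `def`).
* §0 `under_iff_tower` — `B8Ineq132.Under L m y z` ("`z ∈ Bᵐ(y)`") is the tower box `[tlo L y m, thi L y m]` of `B8Ineq130`.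
* §1 **`uLev_eq_glev_local`** — for ANY `U₀, U₁, u` (`L ≥ 1`): if `U′ = U₁^{u}` satisfies the block axial gauge conditions (67) = (1.19)
  on every block of the tower under the level-`j` site `y` and (81) = (1.29) holds at `y`, then at every level `m ≤ j` and every
  level-`m` site `x ∈ B^{j−m}(y)`, `u_m(x) = glev … j m x`; **`eq106_local`** — in particular `u(x) = glev … j 0 x` for every fine
  `x ∈ Bʲ(y)` ("`u₁` … is given by (106)", for `x ∈ Bʲ(Λ_j)`).  **`eq106_of_inAx_restr129`** — the same from the TYPED classes
  `B8Eq119TwistedAxial.InAx` ((1.19)/(1.34)) and `Restr129` ((1.29)/(1.68)) at every `y ∈ Λ_j`, `j ≤ k`.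
* §2 CONSEQUENCES FOR `u₁` ITSELF (with `B8Ineq172Concrete`): under (1.19) in the tower + (1.29) at `y` and the LOCAL regularity
  hypotheses of `B8Ineq172Concrete.ineq172_local` ((1.33) and (1.69) on `Bʲ(y)` only, `|B_b| ≤ c·L^{−j}`, `c = B₁(α₀ + α₁)`):
  `ineq172_local_of_axial` — `|u₁(x) − 1| ≤ 40d·c` on `Bʲ(y)` ((1.72)); `ineq173_local_of_axial` — `|(\overline{R₀u₁}ᵐ)(z) − 1| ≤ 40d·c` on
  the tower ((1.73)); `ineq174_local_of_axial` — (1.74) `≤ 4d·c·L^{m+1}·L^{−j}`; and (with `B8Eq1115Concrete`) `eq214_local_of_axial` — the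
  (213)–(214) remainder bound of (1.115)/(1.121) for `Q′_m(u₁, λ)` with the genuine `u₁`.

READINGS / DECLARED DEVIATIONS: as `B8Ineq172Concrete` (ℤᵈ per level; `𝔸` complete normed `ℂ`-algebra; `G ⊂ U1` averaging-closed;
`<` typed `≤`; explicit sufficient constants `40d`); `U₁ = e^{B}` in the lineage's exponential convention; §1 is pure algebra (no
smallness, any background).  NOT CLAIMED: the inductive hypothesis itself (Theorem 4 at `k − 1`), (1.75) ff.  Unit `pub-ymgap-dag-n04-b`
(YM Track A, node N05 [B8]), 2026-08-25.  Tree API by name only (`B8Eq131Derivation.eq87_local`, `ax119_iff_ax67`, `under_*`;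
`B7Eq84Concrete.glev_of_lt`/`glev_top`/`eq72_iff_eq76`/`fl_decomp`; `B8Ineq130.fl_mem`; `B8Ineq172Concrete` §1–§3), nothing restated.
-/

noncomputable section

open NormedSpace Finset

namespace Literature.MathematicalPhysics.QuantumFieldTheory.Balaban1983to89.B8Eq106Local

open B7Prop1Explicit B7Prop2Explicit B7Prop3Flat B7Prop1Local B7Eq92Concrete B7Eq99Concrete B7Eq84Concrete B7AvgGaugeCovariance
open B8Ineq130 (fl tlo thi tlo_apply thi_apply fl_mem inBox_of_le)
open B8Ineq132 (Under)
open B8Eq131Derivation (under_zero_iff eq87_local ax119_iff_ax67)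
open B8Eq119TwistedAxial (InAx Restr129)
open B8Eq178Averages (restr129_iff_uavg)
open B8Ineq172Concrete (uavg_congr_tower expr167_congr_tower ineq172_local ineq173_local ineq174_local)
open B7Eq170Flat (cj)
open B7Prop10General (C6 C4G)
open B7Eq214General (Cgen)
open B8Eq1115Concrete (utilG_congr_tower eq214_local_B8)

-- `Site` alone could resolve to the torus sites of `Setup.lean`; re-export the `ℤ^d` sites of `B7Prop1Explicit`.
export B7Prop1Explicit (Site)

variable {d : ℕ}

/-! ## §0 `Under` is the tower box -/

/-- **"`z ∈ Bᵐ(y)`" in the two tree spellings**: `B8Ineq132.Under L m y z` ⟺ `tlo L y m ≤ z ≤ thi L y m` (`B8Ineq130`'s tower with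
`lo = hi = y`). [cite: Balaban1985RegularSpaces, p.79 ("x₀ ∈ Bʲ(x_j)")] -/
theorem under_iff_tower (L m : ℕ) (y z : Site d) : Under L m y z ↔ tlo L y m ≤ z ∧ z ≤ thi L y m := by
  constructor
  · intro h
    exact ⟨fun i => by rw [tlo_apply]; exact (h i).1, fun i => by rw [thi_apply]; linarith [(h i).2]⟩
  · rintro ⟨h1, h2⟩ i
    have h1i := h1 i
    have h2i := h2 i
    rw [tlo_apply] at h1i
    rw [thi_apply] at h2i
    exact ⟨h1i, by linarith⟩

/-! ## §1 "`u₁` is determined uniquely in terms of `U₁` and is given by (106)" on the tower under one site -/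

section Identification

variable {𝔸 : Type*} [NormedRing 𝔸] [NormedAlgebra ℂ 𝔸] [CompleteSpace 𝔸]

/-- **LOCAL UNIQUENESS OF THE GAUGE FIXING OF [3] = B8 p. 88 "`u₁` … is given by (106)", LEVEL BY LEVEL.**  Let `U′ = U₁^{u}` (moving
frame (55) at `U₀`) satisfy the block axial gauge conditions (67) of [3] (= (1.19)) on every block of the tower under the level-`j`
site `y` — levels `n < j`, corners `Lz` with `z ∈ B^{j−n−1}(y)` — and let (81) of [3] (= (1.29)) hold at `y`: `(\overline{R₀u}ʲ)(y) = 1`.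
Then for every `m ≤ j` and every level-`m` site `x ∈ B^{j−m}(y)`, `u_m(x) = glev … j m x`: the gauge transformation read at level `m`
IS the level-`m` function of the construction (87) + (76) (`B7Eq84Concrete.glev`).  Print's induction (77) downwards: (87) at `y`
(`B8Eq131Derivation.eq87_local`), then (76) on each block pins the block values from the centre value (`eq72_iff_eq76`).  Pure algebra:
no smallness, any background, `L ≥ 1`. [cite: Balaban1985RegularSpaces, p.88 (sentence after (1.69)), (1.19) p.79, (1.29) p.81; Balaban1985Averaging, (76)–(77) p.29–30, (87) p.31, (106) p.33] -/
theorem uLev_eq_glev_local (L : ℕ) (hL : 1 ≤ L) (U₀ U₁ : Site d → Fin d → 𝔸ˣ) (u : Site d → 𝔸ˣ) (j : ℕ) (y : Site d)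
    (hax : ∀ n, n < j → ∀ z : Site d, Under L (j - (n + 1)) y z → ∀ r : Fin d → Fin L,
      tHol (avgIter L U₀ n) (tildIter L U₀ (mgauge U₀ u U₁) n) ((L : ℤ) • z) (treeWord (boxVec L r)) = 1)
    (h129 : uavg L U₀ u j y = 1) :
    ∀ (n m : ℕ), n + m = j → ∀ x : Site d, Under L n y x → uLev L u m x = glev L hL U₀ U₁ j m x := by
  intro n
  induction n with
  | zero =>
    intro m hm x hx
    have hmj : m = j := by omega
    subst hmj
    rw [(under_zero_iff L y x).1 hx, glev_top]
    exact eq87_local L hL U₀ U₁ u m y hax h129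
  | succ n ih =>
    intro m hm x hx
    have hmj : m < j := by omega
    obtain ⟨hx1, hx2⟩ := (under_iff_tower L (n + 1) y x).1 hx
    obtain ⟨hf, hf'⟩ := fl_mem hL hx1 hx2
    have hz : Under L n y (fl L x) := (under_iff_tower L n y (fl L x)).2 ⟨hf, hf'⟩
    -- (76) on the block of `x_{m+1} = fl x` at level `m`, from (67) there (`j − (m+1) = n`)
    have h67 := hax m hmj (fl L x) (by rw [show j - (m + 1) = n by omega]; exact hz) (brem L hL x)
    rw [tildIter_mgauge] at h67
    have h76 := (eq72_iff_eq76 (avgIter L U₀ m) (tildIter L U₀ U₁ m) (uLev L u m) ((L : ℤ) • fl L x)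
      ((L : ℤ) • fl L x + boxVec L (brem L hL x))).1
    rw [add_sub_cancel_left] at h76
    have h76' := h76 h67
    rw [R0fun_apply, add_sub_cancel_left, fl_decomp hL x, uLev_smul, ih (m + 1) (by omega) (fl L x) hz] at h76'
    rw [glev_of_lt L hL U₀ U₁ hmj, ← h76']
    exact ((Rc_inv_apply _ _).1).symm

/-- **(106) on the fine block**: under the hypotheses of `uLev_eq_glev_local`, `u(x) = glev … j 0 x` for every fine site `x ∈ Bʲ(y)` —
"`u₁` … is given by (106)" for `x ∈ Bʲ(Λ_j)` (B8 p. 88). [cite: Balaban1985RegularSpaces, p.88 (sentence after (1.69)); Balaban1985Averaging, (106) p.33] -/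
theorem eq106_local (L : ℕ) (hL : 1 ≤ L) (U₀ U₁ : Site d → Fin d → 𝔸ˣ) (u : Site d → 𝔸ˣ) (j : ℕ) (y : Site d)
    (hax : ∀ n, n < j → ∀ z : Site d, Under L (j - (n + 1)) y z → ∀ r : Fin d → Fin L,
      tHol (avgIter L U₀ n) (tildIter L U₀ (mgauge U₀ u U₁) n) ((L : ℤ) • z) (treeWord (boxVec L r)) = 1)
    (h129 : uavg L U₀ u j y = 1) (x : Site d) (hx : Under L j y x) : u x = glev L hL U₀ U₁ j 0 x := by
  have h := uLev_eq_glev_local L hL U₀ U₁ u j y hax h129 j 0 (by omega) x hx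
  rwa [uLev_zero] at h

/-- **… for the TYPED classes of B8**: if `U′U₀ ∈ Ax_k(𝔅_k, U₀)` (`B8Eq119TwistedAxial.InAx`, (1.19)/(1.34)) with `U′ = U₁^{u}` ((1.17) = (55)),
and `u` satisfies (1.29) (`B8Eq119TwistedAxial.Restr129`; for the inductive `u₁` this is (1.68) on the honest sets), then for every
`j ≤ k`, every `y ∈ Λ_j` and every fine site `x ∈ Bʲ(y)`: `u(x) = glev … j 0 x` — the gauge transformation on `Bʲ(Λ_j)` "in terms of `U₁`".
[cite: Balaban1985RegularSpaces, p.88 (sentence after (1.69)), (1.19) p.79, (1.29) p.81, (1.34) p.82; Balaban1985Averaging, (106) p.33] -/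
theorem eq106_of_inAx_restr129 (L : ℕ) (hL : 1 ≤ L) (k : ℕ) (Λ : ℕ → Set (Site d)) (U₀ U₁ : Site d → Fin d → 𝔸ˣ)
    (u : Site d → 𝔸ˣ) (hAx : InAx L k Λ U₀ (mgauge U₀ u U₁ * U₀)) (h129 : Restr129 L k Λ U₀ u)
    {j : ℕ} (hjk : j ≤ k) {y : Site d} (hy : y ∈ Λ j) (x : Site d) (hx : Under L j y x) :
    u x = glev L hL U₀ U₁ j 0 x := by
  rw [restr129_iff_uavg] at h129
  refine eq106_local L hL U₀ U₁ u j y (fun n hn z hz r => ?_) (h129 j hjk y hy) x hx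
  exact (ax119_iff_ax67 L U₀ (mgauge U₀ u U₁) n z r).1 (hAx j (by omega) hjk y hy n hn z hz r)

end Identification

/-! ## §2 (1.72)–(1.74) for the inductive gauge transformation `u₁` itself -/

section Consequences

variable {𝔸 : Type*} [NormedRing 𝔸] [NormedAlgebra ℂ 𝔸] [CompleteSpace 𝔸] [NormOneClass 𝔸]
variable {L : ℕ} {G : Subgroup 𝔸ˣ} {j : ℕ} {y : Site d} {U₀ : Site d → Fin d → 𝔸ˣ} {α₀ : ℝ} {B : Site d → Fin d → 𝔸} {c : ℝ}
  {u₁ : Site d → 𝔸ˣ}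

/-- **(1.72) FOR `u₁` ITSELF, LOCAL HYPOTHESES** (p. 88: "`|u₁(x) − 1| < … ≦ 16dB₁(α₀ + α₁)`", for `x ∈ Bʲ(Λ_j)`): let `u₁` bring `U₁ = e^{B}`
to the block axial gauge (1.19) = (67) relative to `U₀` on the tower under the level-`j` site `y` and satisfy (1.29) = (81) at `y`
((1.68)); let `U₀` be `G`-valued (`G ⊂ U1` averaging-closed) and regular on the fine block `Bʲ(y)` only ((1.33) at level `j`), and
`|B_b| ≤ c·L^{−j}` on the bonds of `Bʲ(y)` ((1.69), `c = B₁(α₀ + α₁)`), with the (`j`-free) smallness of `B8Ineq172Concrete.ineq172_local`.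
Then `|u₁(x) − 1| ≤ 40d·c` at every fine site `x ∈ Bʲ(y)`.  (= `ineq172_local` transported along `eq106_local`.)
[cite: Balaban1985RegularSpaces, (1.70)–(1.72) p.88, (1.19) p.79, (1.29) p.81; Balaban1985Averaging, (106) p.33] -/
theorem ineq172_local_of_axial (hL : 2 ≤ L) (hG : AvgClosed d L G) (hU₀ : ∀ x κ, U₀ x κ ∈ G)
    (hα : 0 < α₀) (hα3 : C0 d * α₀ ≤ 1 / 3) (hα4 : 4 * α₀ ≤ c2' d L)
    (h33 : pdevOn (tlo L y j) (thi L y j) U₀ < α₀ * (((L : ℝ) ^ j)⁻¹) ^ 2) (hc : 0 ≤ c)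
    (h69 : ∀ (x : Site d) (κ : Fin d), InBox (tlo L y j) (thi L y j) x → InBox (tlo L y j) (thi L y j) (x + e κ) →
      ‖B x κ‖ ≤ c * ((L : ℝ) ^ j)⁻¹)
    (hsmall : Real.exp (4 * (800 * ((d : ℝ) + 1) ^ 2 * ((d : ℝ) + 4)) * α₀) * (1 + 8 * (131072 * ((d : ℝ) + 1) ^ 2) * c) ≤ 2)
    (hc₃ : 2 * c ≤ c3 d L) (hs : 128 * (d : ℝ) * c ≤ 1) (hL1 : 1 ≤ L)
    (hax : ∀ n, n < j → ∀ z : Site d, Under L (j - (n + 1)) y z → ∀ r : Fin d → Fin L,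
      tHol (avgIter L U₀ n) (tildIter L U₀ (mgauge U₀ u₁ (expCfg B)) n) ((L : ℤ) • z) (treeWord (boxVec L r)) = 1)
    (h129 : uavg L U₀ u₁ j y = 1) (x : Site d) (hx : Under L j y x) :
    ‖((u₁ x : 𝔸ˣ) : 𝔸) - 1‖ ≤ 40 * d * c := by
  obtain ⟨hx1, hx2⟩ := (under_iff_tower L j y x).1 hx
  rw [eq106_local L hL1 U₀ (expCfg B) u₁ j y hax h129 x hx]
  exact ineq172_local hL hG hU₀ hα hα3 hα4 h33 hc h69 hsmall hc₃ hs hL1 x hx1 hx2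

/-- **(1.73) FOR `u₁` ITSELF, LOCAL HYPOTHESES** (p. 88: "`|(\overline{R₀u₁ⁿ})(x_n) − 1| < 16dB₁(α₀ + α₁)`"): in the setting of
`ineq172_local_of_axial`, at every level-`m` site `z` of the tower (`z ∈ B^{n}(y)`, `n + m = j`), `|(\overline{R₀u₁}ᵐ)(z) − 1| ≤ 40d·c` (the average
(79)/(80) of `u₁` agrees with that of `glev … j 0` on the tower by the locality `B8Ineq172Concrete.uavg_congr_tower`).
[cite: Balaban1985RegularSpaces, (1.73) p.88; Balaban1985Averaging, (166) p.44, (106) p.33] -/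
theorem ineq173_local_of_axial (hL : 2 ≤ L) (hG : AvgClosed d L G) (hU₀ : ∀ x κ, U₀ x κ ∈ G)
    (hα : 0 < α₀) (hα3 : C0 d * α₀ ≤ 1 / 3) (hα4 : 4 * α₀ ≤ c2' d L)
    (h33 : pdevOn (tlo L y j) (thi L y j) U₀ < α₀ * (((L : ℝ) ^ j)⁻¹) ^ 2) (hc : 0 ≤ c)
    (h69 : ∀ (x : Site d) (κ : Fin d), InBox (tlo L y j) (thi L y j) x → InBox (tlo L y j) (thi L y j) (x + e κ) →
      ‖B x κ‖ ≤ c * ((L : ℝ) ^ j)⁻¹)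
    (hsmall : Real.exp (4 * (800 * ((d : ℝ) + 1) ^ 2 * ((d : ℝ) + 4)) * α₀) * (1 + 8 * (131072 * ((d : ℝ) + 1) ^ 2) * c) ≤ 2)
    (hc₃ : 2 * c ≤ c3 d L) (hs : 128 * (d : ℝ) * c ≤ 1) (hL1 : 1 ≤ L)
    (hax : ∀ n, n < j → ∀ z : Site d, Under L (j - (n + 1)) y z → ∀ r : Fin d → Fin L,
      tHol (avgIter L U₀ n) (tildIter L U₀ (mgauge U₀ u₁ (expCfg B)) n) ((L : ℤ) • z) (treeWord (boxVec L r)) = 1)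
    (h129 : uavg L U₀ u₁ j y = 1) {m n : ℕ} (hmn : n + m = j) (z : Site d) (hz : Under L n y z) :
    ‖((uavg L U₀ u₁ m z : 𝔸ˣ) : 𝔸) - 1‖ ≤ 40 * d * c := by
  obtain ⟨hz1, hz2⟩ := (under_iff_tower L n y z).1 hz
  have hu : ∀ x : Site d, tlo L y j ≤ x → x ≤ thi L y j → u₁ x = glev L hL1 U₀ (expCfg B) j 0 x := fun x hx hx' =>
    eq106_local L hL1 U₀ (expCfg B) u₁ j y hax h129 x ((under_iff_tower L j y x).2 ⟨hx, hx'⟩)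
  rw [uavg_congr_tower hL1 (fun _ _ _ _ => rfl) hu m n hmn z hz1 hz2]
  exact ineq173_local hL hG hU₀ hα hα3 hα4 h33 hc h69 hsmall hc₃ hs hL1 hmn z hz1 hz2

/-- **(1.74) FOR `u₁` ITSELF, LOCAL HYPOTHESES** (p. 89: "`|(\overline{R₀u₁ⁿ})⁻¹(x_{n+1})(R̄ⁿ_{0,x_{n+1}}\overline{R₀u₁ⁿ})(x_n) − 1| < 4dB₁(α₀ + α₁)L^{n+1−j}`"):
in the setting of `ineq172_local_of_axial`, for every level-`(m+1)` site `z ∈ B^{n}(y)` (`n + (m+1) = j`) and every block point `x_m = Lz + r`,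
the left side of (1.74) is `≤ 4d·c·L^{m+1}·L^{−j}`. [cite: Balaban1985RegularSpaces, (1.74) p.89; Balaban1985Averaging, (167) p.44, (106) p.33] -/
theorem ineq174_local_of_axial (hL : 2 ≤ L) (hG : AvgClosed d L G) (hU₀ : ∀ x κ, U₀ x κ ∈ G)
    (hα : 0 < α₀) (hα3 : C0 d * α₀ ≤ 1 / 3) (hα4 : 4 * α₀ ≤ c2' d L)
    (h33 : pdevOn (tlo L y j) (thi L y j) U₀ < α₀ * (((L : ℝ) ^ j)⁻¹) ^ 2) (hc : 0 ≤ c)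
    (h69 : ∀ (x : Site d) (κ : Fin d), InBox (tlo L y j) (thi L y j) x → InBox (tlo L y j) (thi L y j) (x + e κ) →
      ‖B x κ‖ ≤ c * ((L : ℝ) ^ j)⁻¹)
    (hsmall : Real.exp (4 * (800 * ((d : ℝ) + 1) ^ 2 * ((d : ℝ) + 4)) * α₀) * (1 + 8 * (131072 * ((d : ℝ) + 1) ^ 2) * c) ≤ 2)
    (hc₃ : 2 * c ≤ c3 d L) (hs : 128 * (d : ℝ) * c ≤ 1) (hL1 : 1 ≤ L)
    (hax : ∀ n, n < j → ∀ z : Site d, Under L (j - (n + 1)) y z → ∀ r : Fin d → Fin L,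
      tHol (avgIter L U₀ n) (tildIter L U₀ (mgauge U₀ u₁ (expCfg B)) n) ((L : ℤ) • z) (treeWord (boxVec L r)) = 1)
    (h129 : uavg L U₀ u₁ j y = 1) {m n : ℕ} (hmn : n + (m + 1) = j) (z : Site d) (hz : Under L n y z) (r : Fin d → Fin L) :
    ‖((((uavg L U₀ u₁ m ((L : ℤ) • z))⁻¹
          * Rc (hol (avgIter L U₀ m) ((L : ℤ) • z) (treeWord (boxVec L r))) (uavg L U₀ u₁ m ((L : ℤ) • z + boxVec L r)) : 𝔸ˣ)) : 𝔸)
        - 1‖ ≤ 4 * d * c * (L : ℝ) ^ (m + 1) * ((L : ℝ) ^ j)⁻¹ := by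
  obtain ⟨hz1, hz2⟩ := (under_iff_tower L n y z).1 hz
  have hu : ∀ x : Site d, tlo L y j ≤ x → x ≤ thi L y j → u₁ x = glev L hL1 U₀ (expCfg B) j 0 x := fun x hx hx' =>
    eq106_local L hL1 U₀ (expCfg B) u₁ j y hax h129 x ((under_iff_tower L j y x).2 ⟨hx, hx'⟩)
  rw [expr167_congr_tower hL1 (fun _ _ _ _ => rfl) hu hmn hz1 hz2 r]
  exact ineq174_local hL hG hU₀ hα hα3 hα4 h33 hc h69 hsmall hc₃ hs hL1 hmn z hz1 hz2 r

/-- **(213)–(214) OF [3] = THE INPUT OF (1.115)/(1.121) FOR `u₁` ITSELF, LOCAL HYPOTHESES** (pp. 89–90: «the assumptions of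
Proposition 10 are satisfied and we have the representation (213) and the bounds (214) [3]»): in the setting of `ineq172_local_of_axial`
and for `u′ = e^{λ}` with (1.77) in the (207)-form on `Bʲ(y)` only (`‖λ(x)‖ < α₄`, `‖R(U₀(b))λ(b₊) − λ(b₋)‖ < α₄L^{−j}`) and the `j`-free
smallness of `B8Eq1115Concrete.eq214_local_B8`: at every level-`m` site `z ∈ B^{n}(y)` (`n + m = j`),
`‖Q′_m(u₁, λ)(z) − (Q′_mλ)(z)‖ ≤ 16C′_gen(40d·c·α₄ + α₄²)·Lᵐ·L^{−j}` — `B8Eq1115Concrete.eq214_local_B8` transported along `eq106_local`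
(`ũ′ᵐ` sees `u₁` only on the tower, `B8Eq1115Concrete.utilG_congr_tower`).
[cite: Balaban1985RegularSpaces, p.89 (paragraph after (1.76)), (1.115) p.96, (1.121) p.96; Balaban1985Averaging, (213)–(214) p.50, (106) p.33] -/
theorem eq214_local_of_axial (hL : 2 ≤ L) (hG : AvgClosed d L G) (hU₀ : ∀ x κ, U₀ x κ ∈ G)
    (hα : 0 < α₀) (hα3 : C0 d * α₀ ≤ 1 / 3) (hα4 : 4 * α₀ ≤ c2' d L)
    (h33 : pdevOn (tlo L y j) (thi L y j) U₀ < α₀ * (((L : ℝ) ^ j)⁻¹) ^ 2) (hc : 0 ≤ c)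
    (h69 : ∀ (x : Site d) (κ : Fin d), InBox (tlo L y j) (thi L y j) x → InBox (tlo L y j) (thi L y j) (x + e κ) →
      ‖B x κ‖ ≤ c * ((L : ℝ) ^ j)⁻¹)
    (hsmall : Real.exp (4 * (800 * ((d : ℝ) + 1) ^ 2 * ((d : ℝ) + 4)) * α₀) * (1 + 8 * (131072 * ((d : ℝ) + 1) ^ 2) * c) ≤ 2)
    (hc₃ : 2 * c ≤ c3 d L) (hs : 128 * (d : ℝ) * c ≤ 1) (hL1 : 1 ≤ L)
    (hax : ∀ n, n < j → ∀ z : Site d, Under L (j - (n + 1)) y z → ∀ r : Fin d → Fin L,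
      tHol (avgIter L U₀ n) (tildIter L U₀ (mgauge U₀ u₁ (expCfg B)) n) ((L : ℤ) • z) (treeWord (boxVec L r)) = 1)
    (h129 : uavg L U₀ u₁ j y = 1) {α₄ : ℝ} {lam : Site d → 𝔸}
    (hα₄ : 0 < α₄) (h177b : ∀ x : Site d, InBox (tlo L y j) (thi L y j) x → ‖lam x‖ < α₄)
    (h177a : ∀ (x : Site d) (κ : Fin d), InBox (tlo L y j) (thi L y j) x → InBox (tlo L y j) (thi L y j) (x + e κ) →
      ‖cj (U₀ x κ) (lam (x + e κ)) - lam x‖ < α₄ * ((L : ℝ) ^ j)⁻¹)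
    (hα₃' : 40 * d * c ≤ 1 / 200) (hs₁ : 200 * C6 d * α₄ ≤ 1) (hs₂ : 12000 * ((d : ℝ) + 1) * L * α₄ ≤ 1)
    (hs₃ : C4G d L * (α₀ + 40 * d * c + 4 * α₄) ≤ 1)
    (hs₄ : 1024 * ((d : ℝ) + 1) * ((d : ℝ) + 4) * L ^ 2 * α₀ ≤ 1) (hs₅ : 32 * ((d : ℝ) + 1) ^ 2 * C6 d * L ^ 2 * α₀ ≤ 1)
    (hs₆ : 16 * d * B7Prop9Flat.C5' d * C6 d * (L : ℝ) ^ 2 * α₀ ≤ 1) (hs₇ : 8 * d * C6 d * L * α₀ ≤ 1)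
    {m n : ℕ} (hmn : n + m = j) (z : Site d) (hz : Under L n y z) :
    ‖B8Eq178Averages.Qnl L U₀ (fun x => expUnit (lam x)) u₁ m z
        - B7Eq78Linearization.QprimeIter (B7Eq78Linearization.zdBlocking d L) (B8Eq119TwistedAxial.bgT L U₀) m lam z‖
      ≤ 16 * Cgen d * (40 * d * c * α₄ + α₄ ^ 2) * ((L : ℝ) ^ m * ((L : ℝ) ^ j)⁻¹) := by
  obtain ⟨hz1, hz2⟩ := (under_iff_tower L n y z).1 hz
  have hu : ∀ x : Site d, tlo L y j ≤ x → x ≤ thi L y j → u₁ x = glev L hL1 U₀ (expCfg B) j 0 x := fun x hx hx' =>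
    eq106_local L hL1 U₀ (expCfg B) u₁ j y hax h129 x ((under_iff_tower L j y x).2 ⟨hx, hx'⟩)
  rw [B8Eq178Averages.Qnl_eq_mlog_utilG,
    utilG_congr_tower hL1 (U₀' := U₀) (fun _ _ _ _ => rfl) (fun _ _ _ => rfl) hu m n hmn z hz1 hz2,
    ← B8Eq178Averages.Qnl_eq_mlog_utilG]
  exact eq214_local_B8 hL hG hU₀ hα hα3 hα4 h33 hc h69 hsmall hc₃ hs hL1 hα₄ h177b h177a hα₃' hs₁ hs₂ hs₃ hs₄ hs₅ hs₆ hs₇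
    hmn z hz1 hz2

end Consequences

end Literature.MathematicalPhysics.QuantumFieldTheory.Balaban1983to89.B8Eq106Local

end
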